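import Summits.QuantumAdvantage.QuantumAdvantage.Theses.LinnikCubicClassGroups
import Literature.NumberTheory.ModularRoots.CubeRootsModP
import Literature.NumberTheory.ModularRoots.CubeRootsAMM
import Literature.Computability.Complexity.CubeRootsModPLoops
import Literature.Computability.Complexity.CubicNonresidueCoins
import Literature.Barriers.QuantumAdvantage.TensorNetworkContractionPathDecompositionFP
import Literature.Computability.MetaComplexity.GapMINKTNWSampler
import HarnessLib

/-!
# Crux `LinnikCubicClassGroups.PureCubicClassGroupFBQP` (stmt-QuantumAdvantage-11544) — stub `stub_cubeRootsModP`

Line `arakelov-giant-step-cycle`, stub S5b-P2: a randomised polynomial-time program listing the cube roots of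
`m` modulo a prime `p ∤ 3m` in increasing order, correct for all but a `2^{-s}` fraction of the coin strings
`κ` of length `ℓ ≥ (s+1)·24(size p + 2)`.

* the root list `(range p).filter (r ↦ r³ ≡ m)`: `filter_cube_eq_singleton` (`p ≡ 2 (mod 3)`: `[m^{(2p-1)/3}]`),
  `filter_cube_eq_nil` (non-residues), `sortDedup_eq_filter_cube` (`sortDedup [r, rζ, rζ²]` from one root);
* `exists_cubeRoots_codeFP` — the program `roots (p, m, κ)` in the tree's typed polynomial-time algebra
  `CodeFP` (`CodeFP.threeFree`, `CodeFP.strBlocks`, `CodeFP.ammLoop` of `CubeRootsModPLoops.lean`) and its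
  DETERMINISTIC correctness (`amm_correct` of `CubeRootsAMM.lean`): the output IS the root list unless
  `p ≡ 1 (mod 3)`, `m^{(p-1)/3} ≡ 1` and none of the `⌊|κ|/μ⌋` blocks of `μ = size p + 4` coins is an ACCEPTED
  candidate `t` (`t ≢ 0`, `t^{(p-1)/3} ≢ 1`);
* `stub_cubeRootsModP` — the `⌊ℓ/μ⌋ ≥ s + 1` blocks are independent (`NWSamp.uniformProb_forall_blocks` on the
  prefix of length `⌊ℓ/μ⌋·μ`) and each is rejected with probability `≤ 1/2`
  (`uniformProb_cubicReject_le_half` of `CubicNonresidueCoins.lean`): failure probability `≤ (1/2)^{s+1}`.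
-/

set_option linter.dupNamespace false

namespace Summit.QuantumAdvantage.QuantumAdvantage.Theorems.LinnikCubicClassGroups

open Literature.Computability.Complexity (CodeFP uniformProb bitsToNat uniformProb_nonneg uniformProb_empty
  uniformProb_take_of_le uniformProb_cubicReject_le_half)
open Literature.Computability.Complexity.CodeFP
open Literature.Computability.Complexity.ModArith (powM mulM)
open Literature.Computability.Complexity.BlockRejection (uniformProb_mono_len)
open Literature.Computability.MetaComplexity.NWSamp (uniformProb_forall_blocks)
open Literature.NumberTheory.ModularRoots
open Literature.Barriers.QuantumAdvantage (sortDedup sortDedup_spec)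
open Literature.Barriers.QuantumAdvantage.PathFP (sortDedupFP)

/-! ## The increasing list of cube roots -/

/-- The list of cube roots of `m` modulo `p` is increasing. -/
theorem pairwise_lt_filter_cube (p m : ℕ) :
    ((List.range p).filter (fun r => r ^ 3 % p = m % p)).Pairwise (· < ·) :=
  List.pairwise_lt_range.filter _

/-- Membership in the list of cube roots, read in `ZMod p`. -/
theorem mem_filter_cube_iff {p : ℕ} (m c : ℕ) :
    c ∈ (List.range p).filter (fun r => r ^ 3 % p = m % p) ↔ c < p ∧ ((c : ZMod p)) ^ 3 = (m : ZMod p) := by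
  rw [List.mem_filter, List.mem_range, decide_eq_true_eq, ← Nat.cast_pow, ZMod.natCast_eq_natCast_iff']

/-- **`p ≡ 2 (mod 3)`: the unique cube root is `m^{(2p-1)/3}`.** -/
theorem filter_cube_eq_singleton {p : ℕ} (hp : p.Prime) (h2 : p % 3 = 2) (m : ℕ) :
    (List.range p).filter (fun r => r ^ 3 % p = m % p) = [m ^ ((2 * p - 1) / 3) % p] := by
  haveI := Fact.mk hp
  have hr : (((m ^ ((2 * p - 1) / 3) % p : ℕ)) : ZMod p) ^ 3 = (m : ZMod p) := by
    rw [ZMod.natCast_mod, Nat.cast_pow]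
    exact pow_three_pow_two_mul_sub_one_div_three h2 _
  refine (pairwise_lt_filter_cube p m).eq_of_mem_iff (List.pairwise_singleton _ _) fun c => ?_
  rw [mem_filter_cube_iff, List.mem_singleton]
  constructor
  · rintro ⟨hc, h⟩
    rw [← hr] at h
    exact (natCast_inj_of_lt hc (Nat.mod_lt _ hp.pos)).1 (pow_three_injective (by omega) h)
  · rintro rfl
    exact ⟨Nat.mod_lt _ hp.pos, hr⟩

/-- **A non-residue has no cube root** (`p ≡ 1 (mod 3)`, Euler). -/
theorem filter_cube_eq_nil {p : ℕ} (hp : p.Prime) (h3 : 3 ∣ p - 1) {m : ℕ} (hm : (m : ZMod p) ≠ 0)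
    (hres : (m : ZMod p) ^ ((p - 1) / 3) ≠ 1) :
    (List.range p).filter (fun r => r ^ 3 % p = m % p) = [] := by
  haveI := Fact.mk hp
  refine List.filter_eq_nil_iff.2 fun c _ h => hres ?_
  rw [decide_eq_true_eq, ← ZMod.natCast_eq_natCast_iff', Nat.cast_pow] at h
  exact pow_div_three_eq_one_of_pow_three_eq h hm h3

/-- **All cube roots from one**: with `r³ = m ≠ 0`, `ζ³ = 1 ≠ ζ` (residues `< p`), the sorted list of
cube roots of `m` is `sortDedup [r, rζ, rζ²]`. -/
theorem sortDedup_eq_filter_cube {p : ℕ} (hp : p.Prime) {r z m : ℕ} (hr : r < p)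
    (hrm : (r : ZMod p) ^ 3 = m) (hm : (m : ZMod p) ≠ 0) (hz3 : (z : ZMod p) ^ 3 = 1)
    (hz1 : (z : ZMod p) ≠ 1) :
    sortDedup [r, r * z % p, r * (z * z % p) % p] = (List.range p).filter (fun r => r ^ 3 % p = m % p) := by
  haveI := Fact.mk hp
  refine (sortDedup_spec _).1.eq_of_mem_iff (pairwise_lt_filter_cube p m) fun c => ?_
  rw [(sortDedup_spec _).2, mem_filter_cube_iff, pow_three_eq_iff hz3 hz1 hrm hm]
  simp only [List.mem_cons, List.not_mem_nil, or_false]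
  have e2 : ((r * z % p : ℕ) : ZMod p) = r * z := by rw [ZMod.natCast_mod, Nat.cast_mul]
  have e3 : ((r * (z * z % p) % p : ℕ) : ZMod p) = r * z ^ 2 := by
    rw [ZMod.natCast_mod, Nat.cast_mul, ZMod.natCast_mod, Nat.cast_mul, sq]
  constructor
  · rintro (rfl | rfl | rfl)
    · exact ⟨hr, Or.inl rfl⟩
    · exact ⟨Nat.mod_lt _ hp.pos, Or.inr (Or.inl e2)⟩
    · exact ⟨Nat.mod_lt _ hp.pos, Or.inr (Or.inr e3)⟩
  · rintro ⟨hc, h | h | h⟩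
    · exact Or.inl ((natCast_inj_of_lt hc hr).1 h)
    · exact Or.inr (Or.inl ((natCast_inj_of_lt hc (Nat.mod_lt _ hp.pos)).1 (by rw [h, e2])))
    · exact Or.inr (Or.inr ((natCast_inj_of_lt hc (Nat.mod_lt _ hp.pos)).1 (by rw [h, e3])))

/-! ## The program and its deterministic correctness -/

/-- **Cube roots modulo a prime in randomised polynomial time (the deterministic core).** There is a
map `roots (p, m, κ)`, computed on codes in polynomial time, such that for every prime `p ∤ 3m` the
output IS the increasing list of all `r < p` with `r³ ≡ m (mod p)` — unconditionally when
`p ≡ 2 (mod 3)` (the root `m^{(2p-1)/3}`) or when `m` is a cubic non-residue (no root), and, when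
`p ≡ 1 (mod 3)` and `m^{(p-1)/3} ≡ 1`, as soon as ONE of the `⌊|κ|/μ⌋` blocks of `μ = size p + 4` bits
of the coin string `κ` reduces modulo `p` to an accepted `t` (`t ≠ 0`, `t^{(p-1)/3} ≢ 1`): then the
three roots `r, rζ, rζ²` (`ζ = t^{(p-1)/3}`) are produced by the Adleman–Manders–Miller iteration
from the first accepted `t`. -/
theorem exists_cubeRoots_codeFP :
    ∃ roots : ℕ × ℕ × List Bool → List ℕ, CodeFP (pairE natE (pairE natE strE)) (rawE natE) roots ∧
      ∀ (p m : ℕ) (κ : List Bool), p.Prime → ¬ p ∣ 3 * m →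
        (p % 3 = 1 → m ^ ((p - 1) / 3) % p = 1 →
          ∃ i < κ.length / (p.size + 4),
            bitsToNat ((κ.drop (i * (p.size + 4))).take (p.size + 4)) % p ≠ 0 ∧
            (bitsToNat ((κ.drop (i * (p.size + 4))).take (p.size + 4)) % p) ^ ((p - 1) / 3) % p ≠ 1) →
        roots (p, m, κ) = (List.range p).filter (fun r => r ^ 3 % p = m % p) := by
  -- two atoms kept opaque while the program is assembled (their unfolding is expensive)
  obtain ⟨sz, hsz⟩ : ∃ sz : ℕ → ℕ, sz = Nat.size := ⟨_, rfl⟩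
  obtain ⟨tf, htf⟩ : ∃ tf : ℕ → ℕ, tf = fun n => (fun s => if s % 3 = 0 then s / 3 else s)^[n.size] (n - 1) :=
    ⟨_, rfl⟩
  -- codes: input `i = (p, m, κ)`, context `c = (i, t)`, state `(x, b, c, E)`
  let eI : ℕ × ℕ × List Bool → List Bool := pairE natE (pairE natE strE)
  let eC : (ℕ × ℕ × List Bool) × ℕ → List Bool := pairE eI natE
  let eS : ℕ × ℕ × ℕ × ℕ → List Bool := pairE natE (pairE natE (pairE natE natE))
  -- the program, as mathematical maps
  let Q : (ℕ × ℕ × List Bool) × ℕ → ℕ := fun c => max c.1.1 2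
  let T : (ℕ × ℕ × List Bool) × ℕ → ℕ := fun c => (c.1.1 - 1) / 3
  let Z : (ℕ × ℕ × List Bool) × ℕ → ℕ := fun c => powM (Q c) c.2 (T c)
  let SS : (ℕ × ℕ × List Bool) × ℕ → ℕ := fun c => tf c.1.1
  let INIT : (ℕ × ℕ × List Bool) × ℕ → ℕ × ℕ × ℕ × ℕ := fun c =>
    (powM (Q c) c.1.2.1 ((1 + SS c * (3 - SS c % 3)) / 3), powM (Q c) c.1.2.1 (SS c * (3 - SS c % 3)),
      powM (Q c) c.2 (SS c), (c.1.1 - 1) / (9 * SS c))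
  let STEP : (ℕ × ℕ × List Bool) × ℕ → ℕ × ℕ × ℕ × ℕ → ℕ × ℕ × ℕ × ℕ := fun c st =>
    if powM (max c.1.1 2) st.2.1 st.2.2.2 = 1 then
      (st.1, st.2.1, powM (max c.1.1 2) st.2.2.1 3, st.2.2.2 / 3)
    else if powM (max c.1.1 2) st.2.1 st.2.2.2 = Z c then
      (mulM (max c.1.1 2) st.1 (powM (max c.1.1 2) st.2.2.1 2),
        mulM (max c.1.1 2) st.2.1 (powM (max c.1.1 2) st.2.2.1 6),
        powM (max c.1.1 2) st.2.2.1 3, st.2.2.2 / 3)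
    else (mulM (max c.1.1 2) st.1 st.2.2.1, mulM (max c.1.1 2) st.2.1 (powM (max c.1.1 2) st.2.2.1 3),
        powM (max c.1.1 2) st.2.2.1 3, st.2.2.2 / 3)
  let R : (ℕ × ℕ × List Bool) × ℕ → ℕ := fun c => ((STEP c)^[sz c.1.1] (INIT c)).1
  let OUT : (ℕ × ℕ × List Bool) × ℕ → List ℕ := fun c =>
    sortDedup [R c, mulM (Q c) (R c) (Z c), mulM (Q c) (R c) (mulM (Q c) (Z c) (Z c))]
  let BLK : ℕ × ℕ × List Bool → List (List Bool) := fun i =>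
    (List.range (i.2.2.length / (sz i.1 + 4))).map fun j => (i.2.2.drop (j * (sz i.1 + 4))).take (sz i.1 + 4)
  let TOPT : ℕ × ℕ × List Bool → Option ℕ := fun i =>
    ((BLK i).map fun blk => bitsToNat blk % max i.1 2).find?
      fun t => !decide (t = 0) && !decide (powM (max i.1 2) t ((i.1 - 1) / 3) = 1)
  let ROOTS : ℕ × ℕ × List Bool → List ℕ := fun i =>
    if i.1 % 3 = 2 then [powM (max i.1 2) i.2.1 ((2 * i.1 - 1) / 3)]
    else if i.1 % 3 = 1 ∧ powM (max i.1 2) i.2.1 ((i.1 - 1) / 3) = 1 then (TOPT i).elim [] fun t => OUT (i, t)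
    else []
  -- the program, on codes
  have hp : CodeFP eC natE (fun c => c.1.1) := ((fst _ _).fst' :)
  have hm : CodeFP eC natE (fun c => c.1.2.1) := (((fst _ _).snd').fst' :)
  have ht : CodeFP eC natE (fun c => c.2) := (snd _ _ :)
  have hQ : CodeFP eC natE Q := (natMax.comp (hp.pair (const _ 2)) :)
  have hT : CodeFP eC natE T := (natDiv.comp ((natSub.comp (hp.pair (const _ 1))).pair (const _ 3)) :)
  have hZ : CodeFP eC natE Z := (modPow hQ ht hT :)
  have hSS : CodeFP eC natE SS := by rw [show SS = fun c => tf c.1.1 from rfl, htf]; exact threeFree.comp hp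
  have hβ : CodeFP eC natE (fun c => 3 - SS c % 3) :=
    (natSub.comp ((const _ 3).pair (natMod.comp (hSS.pair (const _ 3)))) :)
  have hsβ : CodeFP eC natE (fun c => SS c * (3 - SS c % 3)) := (natMul.comp (hSS.pair hβ) :)
  have hα : CodeFP eC natE (fun c => (1 + SS c * (3 - SS c % 3)) / 3) :=
    (natDiv.comp ((natAdd.comp ((const _ 1).pair hsβ)).pair (const _ 3)) :)
  have hE0 : CodeFP eC natE (fun c => (c.1.1 - 1) / (9 * SS c)) :=
    (natDiv.comp ((natSub.comp (hp.pair (const _ 1))).pair (natMul.comp ((const _ 9).pair hSS))) :)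
  have hINIT : CodeFP eC eS INIT :=
    ((modPow hQ hm hα).pair ((modPow hQ hm hsβ).pair ((modPow hQ ht hSS).pair hE0)) :)
  have hfuel : CodeFP eC unE (fun c => sz c.1.1) := by
    rw [hsz]; exact (strLength.comp (strOfNat.comp hp)).congr fun c => length_natE _
  have hR : CodeFP eC natE R := ((ammLoop.comp ((hp.pair hZ).pair (hINIT.pair hfuel))).fst' :)
  have hOUT : CodeFP eC (rawE natE) OUT :=
    (sortDedupFP.comp ((rawCons natE).comp (hR.pair ((rawCons natE).comp ((modMul hQ hR hZ).pair
      ((rawCons natE).comp ((modMul hQ hR (modMul hQ hZ hZ)).pair (const _ []))))))) :)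
  have hpI : CodeFP eI natE (fun i => i.1) := (fst _ _ :)
  have hmI : CodeFP eI natE (fun i => i.2.1) := ((snd _ _).fst' :)
  have hQI : CodeFP eI natE (fun i => max i.1 2) := (natMax.comp (hpI.pair (const _ 2)) :)
  have hTI : CodeFP eI natE (fun i => (i.1 - 1) / 3) :=
    (natDiv.comp ((natSub.comp (hpI.pair (const _ 1))).pair (const _ 3)) :)
  have hμ : CodeFP eI unE (fun i => sz i.1 + 4) := by
    rw [hsz]
    exact (unAdd.comp ((strLength.comp (strOfNat.comp hpI)).pair (const (eβ := unE) _ 4))).congr fun i => by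
      simp [length_natE]
  have hBLK : CodeFP eI (rawE strE) BLK := (strBlocks.comp (hμ.pair (snd _ _).snd') :)
  have hcand : CodeFP (pairE natE strE) natE (fun q => bitsToNat q.2 % q.1) :=
    (natMod.comp ((strVal.comp (snd _ _)).pair (fst _ _)) :)
  have hcands : CodeFP eI (rawE natE) (fun i => (BLK i).map fun blk => bitsToNat blk % max i.1 2) :=
    ((map hcand).comp (hQI.pair hBLK) :)
  have hpred : CodeFP (pairE (pairE natE natE) natE) bitE
      (fun q => !decide (q.2 = 0) && !decide (powM q.1.1 q.2 q.1.2 = 1)) :=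
    ((natEq.comp ((snd _ _).pair (const _ 0))).not.and
      (natEq.comp ((modPow (fst _ _).fst' (snd _ _) (fst _ _).snd').pair (const _ 1))).not :)
  have hTOPT : CodeFP eI (optE natE) TOPT := ((rawFind? hpred).comp ((hQI.pair hTI).pair hcands) :)
  have hcase : CodeFP (pairE eI (optE natE)) (rawE natE) (fun q => q.2.elim [] fun t => OUT (q.1, t)) :=
    (optCases (k := fun i o => o.elim [] fun t => OUT (i, t)) (const eI []) hOUT (fun _ => rfl) (fun _ _ => rfl) :)
  have hbr1 : CodeFP eI (rawE natE) (fun i => (TOPT i).elim [] fun t => OUT (i, t)) :=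
    (hcase.comp ((CodeFP.id eI).pair hTOPT) :)
  have hbr2 : CodeFP eI (rawE natE) (fun i => [powM (max i.1 2) i.2.1 ((2 * i.1 - 1) / 3)]) :=
    ((rawSingleton natE).comp (modPow hQI hmI (natDiv.comp ((natSub.comp ((natMul.comp ((const _ 2).pair hpI)).pair
      (const _ 1))).pair (const _ 3)))) :)
  have hmod3 : CodeFP eI natE (fun i => i.1 % 3) := (natMod.comp (hpI.pair (const _ 3)) :)
  have hc2 : CodeFP eI bitE (fun i => decide (i.1 % 3 = 2)) := (natEq.comp (hmod3.pair (const _ 2)) :)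
  have hc1 : CodeFP eI bitE (fun i => decide (i.1 % 3 = 1) && decide (powM (max i.1 2) i.2.1 ((i.1 - 1) / 3) = 1)) :=
    ((natEq.comp (hmod3.pair (const _ 1))).and (natEq.comp ((modPow hQI hmI hTI).pair (const _ 1))) :)
  have hROOTS : CodeFP eI (rawE natE) ROOTS :=
    (hc2.ite hbr2 (hc1.ite hbr1 (const _ []))).congr fun i => by
      simp only [ROOTS, Bool.and_eq_true, decide_eq_true_eq]
  refine ⟨ROOTS, hROOTS, ?_⟩
  -- correctness on primes
  subst hsz htf
  intro p m κ hpr hpm hgood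
  haveI := Fact.mk hpr
  have hp2 : 2 ≤ p := hpr.two_le
  have hq : max p 2 = p := max_eq_left hp2
  have hm0 : (m : ZMod p) ≠ 0 := by
    rw [Ne, ZMod.natCast_eq_zero_iff]
    exact fun h => hpm (dvd_mul_of_dvd_right h 3)
  have castpow : ∀ u v : ℕ, ((powM p u v : ℕ) : ZMod p) = (u : ZMod p) ^ v := fun u v => by
    rw [powM, if_pos hp2, ZMod.natCast_mod, Nat.cast_pow]
  have powlt : ∀ u v : ℕ, powM p u v < p := fun u v => by
    rw [powM, if_pos hp2]; exact Nat.mod_lt _ hpr.pos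
  show ROOTS (p, m, κ) = _
  by_cases h2 : p % 3 = 2
  · simp only [ROOTS, if_pos h2, hq]
    rw [filter_cube_eq_singleton hpr h2, powM, if_pos hp2]
  have h1 : p % 3 = 1 := by
    have hp3 : p % 3 ≠ 0 := fun h => by
      rcases (Nat.dvd_prime hpr).1 (Nat.dvd_of_mod_eq_zero h) with h | h
      · omega
      · exact hpm (h ▸ dvd_mul_right 3 m)
    omega
  have h3 : 3 ∣ p - 1 := by omega
  simp only [ROOTS, if_neg h2, h1, true_and, hq]
  by_cases hres : powM p m ((p - 1) / 3) = 1
  swap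
  · rw [if_neg hres, filter_cube_eq_nil hpr h3 hm0]
    intro h
    apply hres
    rw [← natCast_inj_of_lt (powlt _ _) hpr.one_lt, castpow, h, Nat.cast_one]
  rw [if_pos hres]
  have hres' : m ^ ((p - 1) / 3) % p = 1 := by rwa [powM, if_pos hp2] at hres
  -- an accepted block exists, so the search returns some accepted `t`
  obtain ⟨i, hi, hgi⟩ := hgood h1 hres'
  have hsome : (TOPT (p, m, κ)).isSome := by
    rw [Option.isSome_iff_ne_none]
    intro hnone
    have hx : bitsToNat ((κ.drop (i * (p.size + 4))).take (p.size + 4)) % max p 2 ∈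
        (BLK (p, m, κ)).map (fun blk => bitsToNat blk % max p 2) :=
      List.mem_map.2 ⟨_, List.mem_map.2 ⟨i, List.mem_range.2 hi, rfl⟩, rfl⟩
    have hneg := List.find?_eq_none.1 hnone _ hx
    simp only [hq, Bool.and_eq_true, Bool.not_eq_true', decide_eq_false_iff_not, not_and, not_not] at hneg
    have h' := hneg hgi.1
    rw [powM, if_pos hp2] at h'
    exact hgi.2 h'
  obtain ⟨t, htopt⟩ := Option.isSome_iff_exists.1 hsome
  rw [htopt, Option.elim_some]
  -- the accepted `t`
  have htspec := List.find?_some htopt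
  simp only [Bool.and_eq_true, Bool.not_eq_true', decide_eq_false_iff_not, hq] at htspec
  have htmem := List.mem_of_find?_eq_some htopt
  simp only [List.mem_map, hq] at htmem
  obtain ⟨blk, -, rfl⟩ := htmem
  set t := bitsToNat blk % p with htdef
  have htlt : t < p := Nat.mod_lt _ hpr.pos
  have ht0 : (t : ZMod p) ≠ 0 := fun h =>
    htspec.1 ((natCast_inj_of_lt htlt hpr.pos).1 (by rw [h, Nat.cast_zero]))
  have htT : (t : ZMod p) ^ ((p - 1) / 3) ≠ 1 := fun h => htspec.2 (by
    rw [← natCast_inj_of_lt (powlt _ _) hpr.one_lt, castpow, h, Nat.cast_one])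
  -- `p - 1 = 3ᵏ · s`
  obtain ⟨hs3, k, hk, hks⟩ := not_dvd_iterate_div_three (fun s => if s % 3 = 0 then s / 3 else s)
    (fun _ => rfl) (s₀ := p - 1) (N := p.size) (by omega)
    (lt_of_le_of_lt (Nat.sub_le p 1) (Nat.lt_size_self p))
  set s := (fun s => if s % 3 = 0 then s / 3 else s)^[p.size] (p - 1) with hsdef
  have hk1 : 1 ≤ k := by
    rcases Nat.eq_zero_or_pos k with rfl | h
    · rw [pow_zero, mul_one] at hks
      rw [← hks] at h3
      exact absurd h3 hs3
    · exact h
  have hps : p - 1 = 3 ^ k * s := by rw [← hks, mul_comm]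
  have hmres : (m : ZMod p) ^ ((p - 1) / 3) = 1 := by
    rw [← castpow, hres, Nat.cast_one]
  -- the iteration computes a cube root
  have hcorr := amm_correct (p := p) (N := p.size) hs3 hk1 hps (by omega) ht0 htT hm0 hmres
    (STEP ((p, m, κ), t))
    (fun x b c E => by
      simp only [STEP, Z, Q, T, hq, powM, mulM, if_pos hp2])
  have hR : R ((p, m, κ), t) = ((STEP ((p, m, κ), t))^[p.size]
      (m ^ ((1 + s * (3 - s % 3)) / 3) % p, m ^ (s * (3 - s % 3)) % p, t ^ s % p, (p - 1) / (9 * s))).1 := by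
    simp only [R, INIT, SS, Q, hq, powM, if_pos hp2, ← hsdef]
  rw [← hR] at hcorr
  -- the root of unity
  have hZv : Z ((p, m, κ), t) = powM p t ((p - 1) / 3) := by simp only [Z, Q, T, hq]
  have hζ3 : ((powM p t ((p - 1) / 3) : ℕ) : ZMod p) ^ 3 = 1 := by
    rw [castpow, ← pow_mul, Nat.div_mul_cancel h3]
    exact ZMod.pow_card_sub_one_eq_one ht0
  have hζ1 : ((powM p t ((p - 1) / 3) : ℕ) : ZMod p) ≠ 1 := by rwa [castpow]
  simp only [OUT, Q, hq, mulM, hZv]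
  exact sortDedup_eq_filter_cube hpr hcorr.1 hcorr.2 hm0 hζ3 hζ1

/-! ## The failure probability -/

/-- **S5b-P2 `stub_cubeRootsModP`.** A randomised polynomial-time program listing the cube roots of `m`
modulo a prime `p ∤ 3m` in increasing order, correct for all but a `2^{-s}` fraction of the coin strings
`κ` of length `ℓ ≥ (s+1)·24(size p + 2)`: the deterministic cases are always right, and for `p ≡ 1 (mod 3)`
with `m` a cubic residue the output is wrong only if none of the `⌊ℓ/(size p + 4)⌋ ≥ s + 1` independent
coin blocks is an accepted cubic non-residue, an event of probability `≤ (1/2)^{s+1}`. -/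
theorem stub_cubeRootsModP :
    ∃ roots : ℕ × ℕ × List Bool → List ℕ, CodeFP (pairE natE (pairE natE strE)) (rawE natE) roots ∧
      ∀ (p m : ℕ), p.Prime → ¬ p ∣ 3 * m → ∀ (s ℓ : ℕ), (s + 1) * (24 * (Nat.size p + 2)) ≤ ℓ →
        uniformProb ℓ {κ | roots (p, m, κ) ≠ (List.range p).filter (fun r => r ^ 3 % p = m % p)} ≤ (1 / 2) ^ s := by
  obtain ⟨roots, hfp, hspec⟩ := exists_cubeRoots_codeFP
  refine ⟨roots, hfp, fun p m hp hpm s ℓ hℓ => ?_⟩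
  by_cases hcase : p % 3 = 1 ∧ m ^ ((p - 1) / 3) % p = 1
  swap
  · have hall : ∀ κ, roots (p, m, κ) = (List.range p).filter (fun r => r ^ 3 % p = m % p) :=
      fun κ => hspec p m κ hp hpm fun h1 h2 => absurd ⟨h1, h2⟩ hcase
    have hempty : {κ | roots (p, m, κ) ≠ (List.range p).filter (fun r => r ^ 3 % p = m % p)} = (∅ : Set (List Bool)) :=
      Set.ext fun κ => by simp [hall κ]
    rw [hempty, uniformProb_empty]
    positivity
  obtain ⟨h1, hres⟩ := hcase
  set μ := p.size + 4 with hμ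
  set J := ℓ / μ with hJ
  set Bad : Set (List Bool) := {z | ¬ (bitsToNat z % p ≠ 0 ∧ (bitsToNat z % p) ^ ((p - 1) / 3) % p ≠ 1)}
    with hBad
  -- wrong output forces every block to be rejected
  have hsub : uniformProb ℓ {κ | roots (p, m, κ) ≠ (List.range p).filter (fun r => r ^ 3 % p = m % p)} ≤
      uniformProb ℓ {κ | ∀ i < J, (κ.drop (i * μ)).take μ ∈ Bad} := by
    refine uniformProb_mono_len fun κ hκ hne i hi => ?_
    by_contra hgood
    refine hne (hspec p m κ hp hpm fun _ _ => ⟨i, ?_, not_not.1 hgood⟩)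
    rw [hκ]
    exact hi
  -- the event only reads the first `J μ` coins
  have hJμ : J * μ ≤ ℓ := Nat.div_mul_le_self ℓ μ
  have hset : {κ : List Bool | ∀ i < J, (κ.drop (i * μ)).take μ ∈ Bad} =
      {κ | κ.take (J * μ) ∈ {w : List Bool | ∀ i < J, (w.drop (i * μ)).take μ ∈ Bad}} := by
    ext κ
    simp only [Set.mem_setOf_eq]
    refine forall₂_congr fun i hi => ?_
    have hle : μ ≤ J * μ - i * μ := by
      have : (i + 1) * μ ≤ J * μ := Nat.mul_le_mul_right μ hi
      rw [Nat.succ_mul] at this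
      omega
    rw [List.drop_take, List.take_take, min_eq_left hle]
  have hblk := uniformProb_cubicReject_le_half hp h1
  have hJs : s + 1 ≤ J := by
    rw [hJ, Nat.le_div_iff_mul_le (by omega)]
    exact le_trans (Nat.mul_le_mul_left _ (by omega)) hℓ
  calc uniformProb ℓ {κ | roots (p, m, κ) ≠ (List.range p).filter (fun r => r ^ 3 % p = m % p)}
      ≤ uniformProb ℓ {κ | ∀ i < J, (κ.drop (i * μ)).take μ ∈ Bad} := hsub
    _ = uniformProb μ Bad ^ J := by rw [hset, uniformProb_take_of_le hJμ, uniformProb_forall_blocks]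
    _ ≤ (1 / 2) ^ J := pow_le_pow_left₀ (uniformProb_nonneg _ _) hblk J
    _ ≤ (1 / 2) ^ (s + 1) := pow_le_pow_of_le_one (by norm_num) (by norm_num) hJs
    _ ≤ (1 / 2) ^ s := pow_le_pow_of_le_one (by norm_num) (by norm_num) (Nat.le_succ s)

end Summit.QuantumAdvantage.QuantumAdvantage.Theorems.LinnikCubicClassGroups
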